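import Literature.NumberTheory.GaloisCohomology.CyclotomicCharacterPPrimary
import Literature.NumberTheory.GaloisRepresentations.ArtinLemmaPrimeOrder
import HarnessLib

/-!
# The character supply of Tate's correction at `p`

The hypothesis `CharSupply` of the tree's `correction_of_characterSupply`
(`CorrectionAtPOfCharacter.lean`, node T-pre of the (F1) campaign of `pub/bsd-cn100` discharging
`poitouTate_sum_localTatePairing_eq_zero` for totally complex `K`): for a number field `K`, a prime
`p`, `m : ℕ` and a finite set `S` of finite places, a cyclic character `ψ : Γ_K ↠ ℤ/p^e`, `e ≥ m + 1`,
cutting out a finite abelian `L ⊆ K̄`, unramified outside a finite set `Q` of places avoiding `S` and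
the places above `p`, whose Frobenius values at the places above `p` have `p`-adic valuation
`≤ e − m − 1`.  It is Tate's auxiliary character (Cassels–Fröhlich VII §10, Step 3 = §10.5): the `p`-primary quotient
of the mod-`q` cyclotomic character for an auxiliary prime `q` modulo which `p` has large `p`-power
order (`exists_prime_orderOf_eq_prime_pow`), assembled from `CyclotomicCharacterPPrimary.lean`.

## Main statement

* `exists_cyclicCharacter_correctionSupply` — the supply, token for token in the binder form of
  `correction_of_characterSupply`.

## References

* J. Tate, *Global class field theory*, in Cassels–Fröhlich, *Algebraic Number Theory* (1967),
  Ch. VII §10 (proof of the reciprocity law), §10.5 (Step 3: cyclic cyclotomic extensions; PDF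
  pp. 230–231 of the held copy `book:editornd-algebraic-number-theory`). [CasselsFrohlichANT1967]
* J. Neukirch, *Algebraic Number Theory* (1999), Ch. II §7 Prop. (7.12), §9 Prop. (9.6). [NeukirchANT1999]
-/

noncomputable section

open Function NumberField IsDedekindDomain Field
open scoped NumberField

namespace Literature.NumberTheory.GaloisCohomology

open Literature.NumberTheory.GaloisRepresentations
open Literature.NumberTheory.GaloisRepresentations.LocalWeilDatum
open Literature.NumberTheory.GaloisRepresentations.IsNonarchimedeanLocalField

variable {K : Type} [Field K] [NumberField K]

/-! ### §1. Places and rational primes -/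

omit [NumberField K] in
/-- Two distinct rational primes do not lie in the same finite place (`a q + b q' = 1`). [folklore] -/
private theorem natCast_not_mem_of_prime_of_ne {q q' : ℕ} (hq : q.Prime) (hq' : q'.Prime) (hne : q ≠ q')
    (v : HeightOneSpectrum (𝓞 K)) (h : (q : 𝓞 K) ∈ v.asIdeal) : (q' : 𝓞 K) ∉ v.asIdeal := by
  intro h'
  have hcop : IsCoprime (q : ℤ) (q' : ℤ) :=
    Nat.isCoprime_iff_coprime.mpr ((Nat.coprime_primes hq hq').mpr hne)
  obtain ⟨a, b, hab⟩ := hcop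
  apply v.isPrime.ne_top
  rw [Ideal.eq_top_iff_one]
  have h1 := congrArg (Int.cast : ℤ → 𝓞 K) hab
  push_cast at h1
  rw [← h1]
  exact v.asIdeal.add_mem (v.asIdeal.mul_mem_left _ h) (v.asIdeal.mul_mem_left _ h')

/-- The set of finite places containing a non-zero element is finite. [folklore] -/
private theorem finite_setOf_mem_asIdeal {x : 𝓞 K} (hx : x ≠ 0) :
    {v : HeightOneSpectrum (𝓞 K) | x ∈ v.asIdeal}.Finite := by
  have h := Ideal.finite_factors (I := Ideal.span {x}) (by simpa using hx)
  refine h.subset fun v hv => ?_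
  exact Ideal.dvd_span_singleton.2 hv

/-- There is a finite place above every rational prime `p` (`p` is not a unit of `𝓞 K`; going-up for
`ℤ ⊆ 𝓞 K`). [folklore] -/
private theorem exists_place_natCast_mem {p : ℕ} (hp : p.Prime) :
    ∃ v : HeightOneSpectrum (𝓞 K), (p : 𝓞 K) ∈ v.asIdeal := by
  have hp' : Prime (p : ℤ) := Nat.prime_iff_prime_int.mp hp
  haveI : (Ideal.span {(p : ℤ)}).IsPrime := (Ideal.span_singleton_prime hp'.ne_zero).mpr hp'
  have hinj : Function.Injective (algebraMap ℤ (𝓞 K)) := (algebraMap ℤ (𝓞 K)).injective_int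
  obtain ⟨Q, -, hQ, hQp⟩ := Ideal.exists_ideal_over_prime_of_isIntegral
    (S := 𝓞 K) (Ideal.span {(p : ℤ)}) ⊥
    (by
      rw [← RingHom.ker_eq_comap_bot, (RingHom.injective_iff_ker_eq_bot _).mp hinj]
      exact bot_le)
  have hmem : (p : ℤ) ∈ Q.comap (algebraMap ℤ (𝓞 K)) := by
    rw [hQp]
    exact Ideal.mem_span_singleton_self _
  have hQbot : Q ≠ ⊥ := fun hQbot => hp'.ne_zero (by
    rw [hQbot, Ideal.mem_comap, Ideal.mem_bot, map_eq_zero_iff _ hinj] at hmem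
    exact hmem)
  refine ⟨⟨Q, hQ, hQbot⟩, ?_⟩
  rw [Ideal.mem_comap, map_natCast] at hmem
  exact hmem

/-! ### §2. The `p`-adic valuation bound in `gcd` form -/

/-- If `u ∈ ℤ/p^e` has additive order `p^a` with `a ≥ m + 1`, then `gcd(u, p^e) = p^{e−a}` divides
`p^{e−m−1}`. [folklore] -/
private theorem gcd_val_dvd_of_addOrderOf_eq {p : ℕ} (hp : p.Prime) {e a m : ℕ} (ha : m + 1 ≤ a)
    {u : ZMod (p ^ e)} (hu : addOrderOf u = p ^ a) : Nat.gcd u.val (p ^ e) ∣ p ^ (e - m - 1) := by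
  have hn0 : p ^ e ≠ 0 := pow_ne_zero _ hp.ne_zero
  haveI : NeZero (p ^ e) := ⟨hn0⟩
  have hord : addOrderOf u = p ^ e / (p ^ e).gcd u.val := by
    conv_lhs => rw [← ZMod.natCast_zmod_val u]
    exact ZMod.addOrderOf_coe _ hn0
  rw [hu] at hord
  obtain ⟨j, hje, hj⟩ := (Nat.dvd_prime_pow hp).mp (Nat.gcd_dvd_left (p ^ e) u.val)
  rw [hj, Nat.pow_div hje hp.pos] at hord
  have hja := Nat.pow_right_injective hp.two_le hord
  rw [Nat.gcd_comm, hj]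
  exact pow_dvd_pow p (by omega)

/-! ### §3. The character supply -/

/-- **The character supply of Tate's correction at `p`** (the interface `CharSupply` of the tree's
assembly `CorrectionAtPOfCharacter`, Cassels–Fröhlich VII §10.5).  For a number field `K`, a prime `p`,
`m : ℕ` and a finite set `S` of finite places there are `e ≥ m + 1`, a cyclic character
`ψ : Γ_K ↠ ℤ/p^e` cutting out a finite abelian `L ⊆ K̄` (`ker ψ = Gal(K̄/L)`), and a finite set `Q`
of finite places (the places above an auxiliary rational prime `q`) such that:
(c1) `Q` avoids `S` and the places above `p`; (c2) `ψ ∘ res_v` kills the inertia group of `Γ_{K_v}`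
for every `v ∉ Q` (`ψ` is unramified outside `Q`); (c4) for every `v ∣ p` and every arithmetic
Frobenius `φ ∈ Γ_{K_v}`, `gcd(ψ(res φ), p^e) ∣ p^{e−m−1}`, i.e. `v_p(ψ(Frob_v)) ≤ e − m − 1`.
Construction: `q` a prime with `p` of order `p^r` modulo `q`, `r > m + 1 + max_{v∣p} N(v)`
(`exists_prime_orderOf_eq_prime_pow`; among `#S + 1` such `r` the primes `q_r` are pairwise distinct
and at most one lies under each place of `S`), `ψ` the `p`-primary quotient of `χ_q`
(`exists_cyclicCharacter_pPrimary_cyclotomic`), `L = K̄^{ker ψ}`; (c2) because `χ_q` is unramified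
at `v ∤ q`, (c4) because `χ_q(Frob_v) = N(v) = p^{f_v}` has order `p^a`, `a ≥ m + 1`.
[cite: CasselsFrohlichANT1967, Ch. VII §10.5 (Step 3)] -/
theorem exists_cyclicCharacter_correctionSupply (p : ℕ) [hp : Fact p.Prime] (m : ℕ)
    (S : Finset (HeightOneSpectrum (𝓞 K))) :
    ∃ (e : ℕ), m + 1 ≤ e ∧ ∃ (ψ : CyclicCharacter (absoluteGaloisGroup K) (p ^ e))
      (L : IntermediateField K (AlgebraicClosure K)) (_ : FiniteDimensional K L) (_ : IsAbelianGalois K L)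
      (Q : Finset (HeightOneSpectrum (𝓞 K))),
      ψ.ker = galFixing K L ∧
      (∀ w ∈ Q, w ∉ S ∧ (p : 𝓞 K) ∉ w.asIdeal) ∧
      (∀ v : HeightOneSpectrum (𝓞 K), v ∉ Q → ∀ σ ∈ absInertia (v.adicCompletion K),
          ψ (absGaloisRestrict K (v.adicCompletion K) σ) = 0) ∧
      (∀ v : HeightOneSpectrum (𝓞 K), (p : 𝓞 K) ∈ v.asIdeal →
          ∀ φ : absoluteGaloisGroup (v.adicCompletion K), IsFrobPow φ 1 →
            Nat.gcd (ψ (absGaloisRestrict K (v.adicCompletion K) φ)).val (p ^ e) ∣ p ^ (e - m - 1)) := by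
  classical
  have hpp : p.Prime := hp.out
  -- the places above `p` and the bound `B` on their residue cardinalities
  have hp0 : (p : 𝓞 K) ≠ 0 := Nat.cast_ne_zero.mpr hpp.ne_zero
  set P : Finset (HeightOneSpectrum (𝓞 K)) := (finite_setOf_mem_asIdeal hp0).toFinset with hPdef
  have hP : ∀ v, v ∈ P ↔ (p : 𝓞 K) ∈ v.asIdeal := fun v => by
    rw [hPdef, Set.Finite.mem_toFinset]; rfl
  set B : ℕ := P.sup (fun v => v.residueCard) with hBdef
  have hB : ∀ v : HeightOneSpectrum (𝓞 K), (p : 𝓞 K) ∈ v.asIdeal → v.residueCard ≤ B :=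
    fun v hv => Finset.le_sup (f := fun v : HeightOneSpectrum (𝓞 K) => v.residueCard) ((hP v).mpr hv)
  set T : ℕ := m + 1 + B + 1 with hTdef
  -- the auxiliary primes `q_r`, `ord_{q_r}(p) = p^r`
  have hq : ∀ r : ℕ, ∃ q : ℕ, q.Prime ∧ (T ≤ r → orderOf (p : ZMod q) = p ^ r) := by
    intro r
    by_cases hr : T ≤ r
    · obtain ⟨q, hq, hord⟩ := exists_prime_orderOf_eq_prime_pow hpp.one_lt (by omega : 1 < r) hpp
      exact ⟨q, hq, fun _ => hord⟩
    · exact ⟨2, Nat.prime_two, fun h => absurd h hr⟩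
  choose qf hqprime hqord using hq
  -- pigeonhole: some `r ∈ [T, T + #S]` with no place of `S` above `q_r`
  have hgood : ∃ r, T ≤ r ∧ ∀ w ∈ S, (qf r : 𝓞 K) ∉ w.asIdeal := by
    by_contra hbad
    push Not at hbad
    let s : Finset ℕ := Finset.Icc T (T + S.card)
    have hs : ∀ r ∈ s, T ≤ r := fun r hr => (Finset.mem_Icc.mp hr).1
    let f : ℕ → HeightOneSpectrum (𝓞 K) := fun r =>
      if h : T ≤ r then (hbad r h).choose else (hbad T le_rfl).choose
    have hf : ∀ r, T ≤ r → f r ∈ S ∧ (qf r : 𝓞 K) ∈ (f r).asIdeal := by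
      intro r hr
      simp only [f, dif_pos hr]
      exact (hbad r hr).choose_spec
    have hmaps : Set.MapsTo f s S := fun r hr => (hf r (hs r hr)).1
    have hcard : S.card < s.card := by
      simp only [s, Nat.card_Icc]
      omega
    obtain ⟨x, hx, y, hy, hxy, hfxy⟩ := Finset.exists_ne_map_eq_of_card_lt_of_maps_to hcard hmaps
    have hqx := (hf x (hs x hx)).2
    have hqy := (hf y (hs y hy)).2
    rw [hfxy] at hqx
    have hne : qf x ≠ qf y := by
      intro h
      have h1 := hqord x (hs x hx)
      have h2 := hqord y (hs y hy)
      rw [h] at h1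
      exact hxy (Nat.pow_right_injective hpp.two_le (h1.symm.trans h2))
    exact natCast_not_mem_of_prime_of_ne (hqprime x) (hqprime y) hne (f y) hqx hqy
  obtain ⟨r, hTr, hrS⟩ := hgood
  set q := qf r with hqdef
  have hqp : q.Prime := hqprime r
  have hordq : orderOf (p : ZMod q) = p ^ r := hqord r hTr
  have hqne : q ≠ p := by
    intro h
    rw [h] at hordq
    haveI : Fact (1 < p) := ⟨hpp.one_lt⟩
    have hzero : orderOf ((p : ℕ) : ZMod p) = 0 := by
      rw [ZMod.natCast_self, orderOf_eq_zero_iff']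
      intro n hn
      rw [zero_pow hn.ne']
      exact zero_ne_one
    rw [hzero] at hordq
    exact pow_ne_zero r hpp.ne_zero hordq.symm
  haveI : Fact q.Prime := ⟨hqp⟩
  haveI : NeZero q := ⟨hqp.ne_zero⟩
  haveI : NeZero (q : K) := ⟨Nat.cast_ne_zero.mpr hqp.ne_zero⟩
  -- the character and its field
  obtain ⟨e, ψ, hψ1, hψord⟩ := exists_cyclicCharacter_pPrimary_cyclotomic K q p
  obtain ⟨L, hLfd, hLab, hker⟩ := CyclicCharacter.exists_ker_eq_galFixing ψ
  -- `Q` = the places above `q`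
  have hq0 : (q : 𝓞 K) ≠ 0 := Nat.cast_ne_zero.mpr hqp.ne_zero
  set Q : Finset (HeightOneSpectrum (𝓞 K)) := (finite_setOf_mem_asIdeal hq0).toFinset with hQdef
  have hQ : ∀ w, w ∈ Q ↔ (q : 𝓞 K) ∈ w.asIdeal := fun w => by
    rw [hQdef, Set.Finite.mem_toFinset]; rfl
  -- orders of Frobenius values at the places above `p`
  have hfrob : ∀ v : HeightOneSpectrum (𝓞 K), (p : 𝓞 K) ∈ v.asIdeal →
      ∀ φ : absoluteGaloisGroup (v.adicCompletion K), IsAbsArithFrob φ →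
        ∃ a, m + 1 ≤ a ∧ addOrderOf (ψ (absGaloisRestrict K (v.adicCompletion K) φ)) = p ^ a := by
    intro v hv φ hφ
    have hvq : (q : 𝓞 K) ∉ v.asIdeal := natCast_not_mem_of_prime_of_ne hpp hqp hqne.symm v hv
    obtain ⟨a, ha, hord⟩ := exists_orderOf_modNCyclotomicCharacter_absGaloisRestrict_eq_prime_pow K q v
      hvq hpp hv hordq (hB v hv) hφ
    exact ⟨a, by omega, hψord _ a hord⟩
  -- `e ≥ m + 1`
  have hme : m + 1 ≤ e := by
    obtain ⟨v₀, hv₀⟩ := exists_place_natCast_mem (K := K) hpp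
    obtain ⟨φ₀, hφ₀⟩ := exists_isAbsArithFrob_holds (v₀.adicCompletion K)
    obtain ⟨a, ha, hord⟩ := hfrob v₀ hv₀ φ₀ hφ₀
    have hdvd := addOrderOf_dvd_natCard (ψ (absGaloisRestrict K (v₀.adicCompletion K) φ₀))
    rw [hord, Nat.card_zmod] at hdvd
    exact le_trans ha ((Nat.pow_dvd_pow_iff_le_right hpp.one_lt).mp hdvd)
  refine ⟨e, hme, ψ, L, hLfd, hLab, Q, hker, fun w hw => ?_, fun v hv σ hσ => ?_, fun v hv φ hφ => ?_⟩
  · -- (c1) `Q` avoids `S` and the places above `p`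
    have hwq := (hQ w).mp hw
    exact ⟨fun hwS => hrS w hwS hwq, natCast_not_mem_of_prime_of_ne hqp hpp hqne w hwq⟩
  · -- (c2) unramified outside `Q`
    have hvq : (q : 𝓞 K) ∉ v.asIdeal := fun h => hv ((hQ v).mpr h)
    exact hψ1 _ (modNCyclotomicCharacter_absGaloisRestrict_eq_one_of_mem_absInertia K q v hvq hσ)
  · -- (c4) the valuation bound at `v ∣ p`
    have hφ' : IsAbsArithFrob φ := isFrobPow_one_iff_isAbsArithFrob_holds.mp hφ
    obtain ⟨a, ha, hord⟩ := hfrob v hv φ hφ'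
    exact gcd_val_dvd_of_addOrderOf_eq hpp ha hord

end Literature.NumberTheory.GaloisCohomology

end
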